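import Mathlib
import HarnessLib
import Summits.Ventures.LatticeQCDFlow.Exactness.LazyRelaxationLagLaw

/-!
# AR1SwitchingProcess — the AR(1) switching model AS A STOCHASTIC PROCESS: its mean trails the
# trap by row 8's lag sequence, its autocovariance is `ρ^{|j−k|}`, and the work has
# `E W = Σ (d_k²/2 + d_k e_k)`, `Var W = Σ d_j d_k ρ^{|j−k|} = 2 E W`

HONEST FRAMING: exact (Metropolis-corrected) sampling algorithms for lattice gauge theory;
figures of merit are autocorrelation/cost numbers at stated couplings and volumes; no
continuum-physics claim.

Venture `LatticeQCDFlow` (cell pub-lqcd), topic `Scaling`; FANOUT row 19 (`su2-snf`, GEN-4).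
OUR WORK (linearity of the mean, bilinearity of the covariance — Mathlib's `ProbabilityTheory.cov`);
nothing is cited as a fact.  Companion of `Scaling/AR1SwitchingLaw` (same row, same night): that
file takes the two finite sums `ar1MeanWork ρ d n = Σ_{k<n} (d_k²/2 + d_k·lagSeq ρ d k)` and
`ar1WorkVar ρ d n = Σ_{j,k<n} d_j d_k ρ^{|j−k|}` as PRIMITIVES and derives the `k′` law from them;
this file constructs the process on an arbitrary probability space and proves that those sums ARE
the mean and the variance of its work.  It imports only row 8's `Exactness.lagSeq` (not
`AR1SwitchingLaw`), so the two files are independent; the conclusions below are written as the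
explicit sums, i.e. the bodies of `ar1MeanWork` / `ar1WorkVar` at `d_k = m_{k+1} − m_k`, and the
bridge is definitional unfolding.

## The process (`Ω` any probability space; `m : ℕ → ℝ` trap centres; `ρ τ : ℝ`; `ξ : ℕ → Ω → ℝ`)

`ar1State m ρ τ ξ`: `y_0 = m_0 + ξ_0`, `y_{k+1} = m_{k+1} + ρ (y_k − m_{k+1}) + τ ξ_{k+1}` — start in
equilibrium in the trap at `m_0`, then per protocol step ONE autoregressive layer towards the new
centre.  `ar1Work m ρ τ ξ n = Σ_{k<n} (S_{k+1}(y_k) − S_k(y_k))`, `S_k(y) = (y − m_k)²/2`: the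
Jarzynski work of the `n` switches, each paid at the state reached before the next layer.
HYPOTHESES (`IsStdInnovations P ξ`, a bundle, our modelling assumption): the `ξ_i` are square
integrable, mean zero, unit variance, pairwise uncorrelated — wide-sense white noise; the physical
case is i.i.d. standard Gaussians (then `y` is the exact heat-bath / over-relaxation / Adler layer
for the Gaussian `N(m_{k+1}, 1)` when `ρ² + τ² = 1`, cf. `Exactness/FreeFieldOverrelaxationExact`),
but only second-order structure is used.  Stationarity of the variance needs `ρ² + τ² = 1`
(hypothesis `hρτ` where used).

## Content (all proved)

* `memLp_ar1State` (states are square integrable); **`integral_ar1State`**: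
  `E y_k = m_k − lagSeq ρ d k`, `d_k = m_{k+1} − m_k` — the mean trails the trap by EXACTLY row 8's
  lag sequence (`Exactness/LazyRelaxationLagLaw`, laziness `ε` ↦ autoregression `ρ`; here `ρ` may
  be negative);
* `covariance_ar1State_succ` (one layer through the covariance: `Cov(X, y_{k+1}) = ρ Cov(X, y_k) +
  τ Cov(X, ξ_{k+1})`), `covariance_xi_ar1State` (innovations are uncorrelated with the past),
  `covariance_ar1State_self` (`Var y_k = 1`), `covariance_ar1State_add`, **`covariance_ar1State`**
  (`Cov(y_j, y_k) = ρ^{|j−k|}`, the AR(1) autocovariance — calibration family C-1 of the scorers);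
* `ar1Work_eq` (the work is a sum of affine functions of the states), **`integral_ar1Work`**
  (`E W = Σ_{k<n} (d_k²/2 + d_k·lagSeq ρ d k)`), **`variance_ar1Work`**
  (`Var W = Σ_{j,k<n} d_j d_k ρ^{|j−k|}`), `sum_sum_pow_dist_eq_two_mul` (the algebraic identity,
  re-proved here to stay independent of `AR1SwitchingLaw.ar1WorkVar_eq_two_mul_meanWork`),
  **`variance_ar1Work_eq_two_mul_integral`** (`Var W = 2 E W` for the process: fluctuation–
  dissipation, every trap path, every `ρ`), `integral_ar1Work_nonneg` (second law `0 ≤ E W`, as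
  `Var ≥ 0`).

NOT CLAIMED / NOT TYPED: Gaussianity of `W` (immediate for Gaussian innovations, not needed for the
moments), Jarzynski's identity `E e^{−W} = 1` for the process (it follows from Gaussianity and
`Var W = 2 E W`; the tree's dictionary `Theory2.gaussianWork_kishESS` turns `Var W` into
`−log ESS`), anything about lattice kernels.
-/

namespace Summit.Ventures.LatticeQCDFlow.Scaling

open MeasureTheory ProbabilityTheory Finset
open Summit.Ventures.LatticeQCDFlow.Exactness (lagSeq lagSeq_zero lagSeq_succ)

variable {Ω : Type*} {mΩ : MeasurableSpace Ω} {P : Measure Ω}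

/-- The state of the AR(1) switching process after `k` layers: `y_0 = m_0 + ξ_0` (equilibrium start,
fluctuation `ξ_0`), `y_{k+1} = m_{k+1} + ρ (y_k − m_{k+1}) + τ ξ_{k+1}` (one autoregressive layer
towards the new trap centre, innovation `ξ_{k+1}`). -/
noncomputable def ar1State (m : ℕ → ℝ) (ρ τ : ℝ) (ξ : ℕ → Ω → ℝ) : ℕ → Ω → ℝ
  | 0 => fun ω => m 0 + ξ 0 ω
  | k + 1 => fun ω => m (k + 1) + ρ * (ar1State m ρ τ ξ k ω - m (k + 1)) + τ * ξ (k + 1) ω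

/-- The work of the `n`-step protocol: `W = Σ_{k<n} (S_{k+1}(y_k) − S_k(y_k))` with the trap actions
`S_k(y) = (y − m_k)²/2` — each switch is paid at the state reached BEFORE the next layer. -/
noncomputable def ar1Work (m : ℕ → ℝ) (ρ τ : ℝ) (ξ : ℕ → Ω → ℝ) (n : ℕ) : Ω → ℝ :=
  fun ω => ∑ k ∈ range n,
    ((ar1State m ρ τ ξ k ω - m (k + 1)) ^ 2 / 2 - (ar1State m ρ τ ξ k ω - m k) ^ 2 / 2)

/-- HYPOTHESIS BUNDLE (our modelling assumption, not a cited result): wide-sense standardised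
innovations — square integrable, mean zero, unit variance, pairwise uncorrelated.  Independent
standard Gaussians are the physical case; only this second-order structure is used below. -/
structure IsStdInnovations (P : Measure Ω) (ξ : ℕ → Ω → ℝ) : Prop where
  memLp : ∀ i, MemLp (ξ i) 2 P
  integral_eq_zero : ∀ i, ∫ ω, ξ i ω ∂P = 0
  cov_self : ∀ i, cov[ξ i, ξ i; P] = 1
  cov_eq_zero : ∀ ⦃i j : ℕ⦄, i ≠ j → cov[ξ i, ξ j; P] = 0

/-- The first state in `Pi` form. -/
theorem ar1State_zero_eq (m : ℕ → ℝ) (ρ τ : ℝ) (ξ : ℕ → Ω → ℝ) :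
    ar1State m ρ τ ξ 0 = (fun _ => m 0) + ξ 0 := by
  funext ω; rfl

/-- One layer in `Pi` form: `y_{k+1} = (1 − ρ) m_{k+1} + ρ y_k + τ ξ_{k+1}`. -/
theorem ar1State_succ_eq (m : ℕ → ℝ) (ρ τ : ℝ) (ξ : ℕ → Ω → ℝ) (k : ℕ) :
    ar1State m ρ τ ξ (k + 1)
      = ((fun _ => (1 - ρ) * m (k + 1)) + fun ω => ρ * ar1State m ρ τ ξ k ω)
          + fun ω => τ * ξ (k + 1) ω := by
  funext ω
  simp only [ar1State, Pi.add_apply]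
  ring

/-- The work as a sum of affine functions of the states (`Pi` form):
`W = Σ_{k<n} (c_k − d_k y_k)` with `d_k = m_{k+1} − m_k`, `c_k = d_k²/2 + d_k m_k`. -/
theorem ar1Work_eq (m : ℕ → ℝ) (ρ τ : ℝ) (ξ : ℕ → Ω → ℝ) (n : ℕ) :
    ar1Work m ρ τ ξ n = fun ω => ∑ k ∈ range n,
      ((fun _ : Ω => (m (k + 1) - m k) ^ 2 / 2 + (m (k + 1) - m k) * m k)
        - (fun ω : Ω => (m (k + 1) - m k) * ar1State m ρ τ ξ k ω) : Ω → ℝ) ω := by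
  funext ω
  simp only [ar1Work, Pi.sub_apply]
  refine sum_congr rfl fun k _ => ?_
  ring

/-- The algebraic identity behind the fluctuation–dissipation relation: the AR(1) covariance form
of the steps is twice (quasi-static part + work against the lag) — the statement of
`AR1SwitchingLaw.ar1WorkVar_eq_two_mul_meanWork`, re-proved here (20 lines) so that this file does
not depend on that one. -/
theorem sum_sum_pow_dist_eq_two_mul (ρ : ℝ) (d : ℕ → ℝ) (n : ℕ) :
    ∑ j ∈ range n, ∑ k ∈ range n, d j * d k * ρ ^ Nat.dist j k
      = 2 * ∑ k ∈ range n, (d k ^ 2 / 2 + d k * lagSeq ρ d k) := by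
  induction n with
  | zero => simp
  | succ n ih =>
      rw [sum_range_succ (n := n) (f := fun k => d k ^ 2 / 2 + d k * lagSeq ρ d k), mul_add, ← ih,
        sum_range_succ]
      simp_rw [sum_range_succ]
      rw [sum_add_distrib, Summit.Ventures.LatticeQCDFlow.Exactness.lagSeq_eq_sum ρ d n]
      have h1 : ∀ j ∈ range n, d j * d n * ρ ^ Nat.dist j n = d n * (ρ ^ (n - j) * d j) := by
        intro j hj
        rw [Nat.dist_eq_sub_of_le (mem_range.mp hj).le]
        ring
      have h2 : ∀ k ∈ range n, d n * d k * ρ ^ Nat.dist n k = d n * (ρ ^ (n - k) * d k) := by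
        intro k hk
        rw [Nat.dist_comm, Nat.dist_eq_sub_of_le (mem_range.mp hk).le]
        ring
      rw [sum_congr rfl h1, sum_congr rfl h2, Nat.dist_self, pow_zero, ← mul_sum]
      ring

section Moments

variable [IsProbabilityMeasure P] {ξ : ℕ → Ω → ℝ} (h : IsStdInnovations P ξ) (m : ℕ → ℝ) (ρ τ : ℝ)
include h

/-- Every state is square integrable. -/
theorem memLp_ar1State : ∀ k, MemLp (ar1State m ρ τ ξ k) 2 P
  | 0 => by
      rw [ar1State_zero_eq]
      have h1 : MemLp (fun _ : Ω => m 0) 2 P := memLp_const _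
      exact h1.add (h.memLp 0)
  | k + 1 => by
      rw [ar1State_succ_eq]
      have h1 : MemLp (fun _ : Ω => (1 - ρ) * m (k + 1)) 2 P := memLp_const _
      exact (h1.add ((memLp_ar1State k).const_mul ρ)).add ((h.memLp (k + 1)).const_mul τ)

/-- **The mean trails the trap by row 8's lag sequence**: `E y_k = m_k − e_k` with
`e = lagSeq ρ d`, `d_k = m_{k+1} − m_k` (laziness ↦ autoregression coefficient). -/
theorem integral_ar1State :
    ∀ k, ∫ ω, ar1State m ρ τ ξ k ω ∂P = m k - lagSeq ρ (fun k => m (k + 1) - m k) k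
  | 0 => by
      have hc : Integrable (fun _ : Ω => m 0) P := integrable_const _
      have hξ : Integrable (ξ 0) P := (h.memLp 0).integrable one_le_two
      rw [ar1State_zero_eq, integral_add' hc hξ, integral_const, h.integral_eq_zero, lagSeq_zero]
      simp
  | k + 1 => by
      have hc : Integrable (fun _ : Ω => (1 - ρ) * m (k + 1)) P := integrable_const _
      have hy : Integrable (fun ω => ρ * ar1State m ρ τ ξ k ω) P :=
        ((memLp_ar1State h m ρ τ k).integrable one_le_two).const_mul ρ
      have hξ : Integrable (fun ω => τ * ξ (k + 1) ω) P :=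
        ((h.memLp (k + 1)).integrable one_le_two).const_mul τ
      rw [ar1State_succ_eq, integral_add' (hc.add hy) hξ, integral_add' hc hy, integral_const]
      rw [integral_const_mul, integral_const_mul, integral_ar1State k, h.integral_eq_zero,
        lagSeq_succ]
      simp only [probReal_univ, smul_eq_mul, one_mul, mul_zero, add_zero]
      ring

/-- One layer, seen through the covariance with any square-integrable `X`:
`Cov(X, y_{k+1}) = ρ Cov(X, y_k) + τ Cov(X, ξ_{k+1})`. -/
theorem covariance_ar1State_succ {X : Ω → ℝ} (hX : MemLp X 2 P) (k : ℕ) :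
    cov[X, ar1State m ρ τ ξ (k + 1); P]
      = ρ * cov[X, ar1State m ρ τ ξ k; P] + τ * cov[X, ξ (k + 1); P] := by
  have hy : MemLp (fun ω => ρ * ar1State m ρ τ ξ k ω) 2 P := (memLp_ar1State h m ρ τ k).const_mul ρ
  have hc : MemLp (fun _ : Ω => (1 - ρ) * m (k + 1)) 2 P := memLp_const _
  have hξ : MemLp (fun ω => τ * ξ (k + 1) ω) 2 P := (h.memLp (k + 1)).const_mul τ
  rw [ar1State_succ_eq, covariance_add_right hX (hc.add hy) hξ, covariance_add_right hX hc hy,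
    covariance_const_right, covariance_const_mul_right, covariance_const_mul_right]
  ring

/-- Innovations are uncorrelated with the past: `Cov(ξ_i, y_k) = 0` for `k < i`. -/
theorem covariance_xi_ar1State : ∀ k i, k < i → cov[ξ i, ar1State m ρ τ ξ k; P] = 0
  | 0, i, hi => by
      have hc : MemLp (fun _ : Ω => m 0) 2 P := memLp_const _
      rw [ar1State_zero_eq, covariance_add_right (h.memLp i) hc (h.memLp 0),
        covariance_const_right, h.cov_eq_zero (Nat.ne_of_gt hi)]
      simp
  | k + 1, i, hi => by
      rw [covariance_ar1State_succ h m ρ τ (h.memLp i) k,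
        covariance_xi_ar1State k i (Nat.lt_of_succ_lt hi), h.cov_eq_zero (Nat.ne_of_gt hi)]
      ring

variable (hρτ : ρ ^ 2 + τ ^ 2 = 1)
include hρτ

/-- Stationary unit variance: with `ρ² + τ² = 1`, `Cov(y_k, y_k) = 1` for every `k`. -/
theorem covariance_ar1State_self : ∀ k, cov[ar1State m ρ τ ξ k, ar1State m ρ τ ξ k; P] = 1
  | 0 => by
      have h0 := memLp_ar1State h m ρ τ 0
      have hc : MemLp (fun _ : Ω => m 0) 2 P := memLp_const _
      rw [ar1State_zero_eq] at h0 ⊢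
      rw [covariance_add_right h0 hc (h.memLp 0), covariance_const_right, zero_add,
        covariance_add_left hc (h.memLp 0) (h.memLp 0), covariance_const_left, zero_add, h.cov_self]
  | k + 1 => by
      have hy1 := memLp_ar1State h m ρ τ (k + 1)
      have hy := memLp_ar1State h m ρ τ k
      rw [covariance_ar1State_succ h m ρ τ hy1 k, covariance_comm,
        covariance_ar1State_succ h m ρ τ hy k, covariance_ar1State_self k,
        covariance_comm (ar1State m ρ τ ξ k), covariance_xi_ar1State h m ρ τ k (k + 1) k.lt_succ_self,
        covariance_comm (ar1State m ρ τ ξ (k + 1)),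
        covariance_ar1State_succ h m ρ τ (h.memLp (k + 1)) k,
        covariance_xi_ar1State h m ρ τ k (k + 1) k.lt_succ_self, h.cov_self]
      linear_combination hρτ

/-- **The AR(1) autocovariance**: `Cov(y_j, y_{j+t}) = ρ^t`. -/
theorem covariance_ar1State_add (j : ℕ) :
    ∀ t, cov[ar1State m ρ τ ξ j, ar1State m ρ τ ξ (j + t); P] = ρ ^ t
  | 0 => by rw [add_zero, pow_zero]; exact covariance_ar1State_self h m ρ τ hρτ j
  | t + 1 => by
      rw [← add_assoc, covariance_ar1State_succ h m ρ τ (memLp_ar1State h m ρ τ j) (j + t),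
        covariance_ar1State_add j t, covariance_comm,
        covariance_xi_ar1State h m ρ τ j (j + t + 1) (by omega)]
      ring

/-- `Cov(y_j, y_k) = ρ^{|j−k|}`. -/
theorem covariance_ar1State (j k : ℕ) :
    cov[ar1State m ρ τ ξ j, ar1State m ρ τ ξ k; P] = ρ ^ Nat.dist j k := by
  rcases le_total j k with hjk | hkj
  · obtain ⟨t, rfl⟩ := Nat.exists_eq_add_of_le hjk
    rw [covariance_ar1State_add h m ρ τ hρτ j t, Nat.dist_eq_sub_of_le hjk, Nat.add_sub_cancel_left]
  · obtain ⟨t, rfl⟩ := Nat.exists_eq_add_of_le hkj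
    rw [covariance_comm, covariance_ar1State_add h m ρ τ hρτ k t, Nat.dist_comm,
      Nat.dist_eq_sub_of_le hkj, Nat.add_sub_cancel_left]

/-! ## The two moments of the work -/

omit hρτ in
/-- **The mean work is `ar1MeanWork`**: `E W = Σ_{k<n} (d_k²/2 + d_k e_k)` with `e = lagSeq ρ d` —
verbatim the body of `Scaling.ar1MeanWork ρ d n` of `AR1SwitchingLaw` at `d_k = m_{k+1} − m_k`. -/
theorem integral_ar1Work (n : ℕ) :
    ∫ ω, ar1Work m ρ τ ξ n ω ∂P = ∑ k ∈ range n,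
      ((m (k + 1) - m k) ^ 2 / 2
        + (m (k + 1) - m k) * lagSeq ρ (fun k => m (k + 1) - m k) k) := by
  have hc : ∀ k, Integrable (fun _ : Ω => (m (k + 1) - m k) ^ 2 / 2 + (m (k + 1) - m k) * m k) P :=
    fun k => integrable_const _
  have hy : ∀ k, Integrable (fun ω => (m (k + 1) - m k) * ar1State m ρ τ ξ k ω) P :=
    fun k => ((memLp_ar1State h m ρ τ k).integrable one_le_two).const_mul _
  rw [ar1Work_eq]
  rw [integral_finsetSum _ fun k _ => (hc k).sub (hy k)]
  refine sum_congr rfl fun k _ => ?_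
  rw [integral_sub' (hc k) (hy k), integral_const, integral_const_mul, integral_ar1State h m ρ τ k]
  simp only [probReal_univ, smul_eq_mul, one_mul]
  ring

/-- **The work variance is `ar1WorkVar`**: `Var W = Σ_{j,k<n} d_j d_k ρ^{|j−k|}` — verbatim the body
of `Scaling.ar1WorkVar ρ d n` of `AR1SwitchingLaw` at `d_k = m_{k+1} − m_k`. -/
theorem variance_ar1Work (n : ℕ) :
    Var[ar1Work m ρ τ ξ n; P] = ∑ j ∈ range n, ∑ k ∈ range n,
      (m (j + 1) - m j) * (m (k + 1) - m k) * ρ ^ Nat.dist j k := by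
  have hc : ∀ k, MemLp (fun _ : Ω => (m (k + 1) - m k) ^ 2 / 2 + (m (k + 1) - m k) * m k) 2 P :=
    fun k => memLp_const _
  have hy : ∀ k, MemLp (fun ω => (m (k + 1) - m k) * ar1State m ρ τ ξ k ω) 2 P :=
    fun k => (memLp_ar1State h m ρ τ k).const_mul _
  rw [ar1Work_eq, variance_fun_sum' fun k _ => (hc k).sub (hy k)]
  refine sum_congr rfl fun j _ => sum_congr rfl fun k _ => ?_
  rw [covariance_sub_left (hc j) (hy j) ((hc k).sub (hy k)), covariance_const_left,
    covariance_sub_right (hy j) (hc k) (hy k), covariance_const_right, covariance_const_mul_left,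
    covariance_const_mul_right, covariance_ar1State h m ρ τ hρτ j k]
  ring

/-- **Fluctuation–dissipation, for the process**: `Var W = 2 E W` (every trap path, every
`ρ, τ` with `ρ² + τ² = 1`) — hence `E W = Var W/2 ≥ 0`, the second law, for free. -/
theorem variance_ar1Work_eq_two_mul_integral (n : ℕ) :
    Var[ar1Work m ρ τ ξ n; P] = 2 * ∫ ω, ar1Work m ρ τ ξ n ω ∂P := by
  rw [variance_ar1Work h m ρ τ hρτ, integral_ar1Work h m ρ τ]
  exact sum_sum_pow_dist_eq_two_mul ρ (fun k => m (k + 1) - m k) n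

/-- The second law for the process: `0 ≤ E W`. -/
theorem integral_ar1Work_nonneg (n : ℕ) : 0 ≤ ∫ ω, ar1Work m ρ τ ξ n ω ∂P := by
  have := variance_ar1Work_eq_two_mul_integral h m ρ τ hρτ n
  linarith [variance_nonneg (ar1Work m ρ τ ξ n) P]

end Moments

end Summit.Ventures.LatticeQCDFlow.Scaling
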